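import Literature.NumberTheory.Automorphic.UnitaryGroupTruncatedTraceClassPolynomialGlue
import HarnessLib

/-!
# Glue, keyed: every class of a socket has a key, the row closer is stated per key ⇒ the finset closer
(Arthur, *The trace formula in invariant form*, Ann. of Math. 114 (1981), Prop. 2.3: `J^T_𝔬(f)` is a polynomial in `log T` and
`J_𝔬(f)` is its constant term; Rogawski, *Automorphic Representations of Unitary Groups in Three Variables* (1990), §2.2–2.3
pp. 13–14 and (6.1.3), (7.2.3), Prop. 7.3.2: the closed forms `A·log T + B` of the three kinds of classes meeting `B(F)`.)

Topic `NumberTheory/Automorphic`; namespace `Literature.NumberTheory.Automorphic.UnitaryGroup`. THEOREMS ONLY over the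
accepted ★ GLUE `UnitaryGroupTruncatedTraceClassPolynomialGlue` (no definition, no named fact, no instance, no notation, no
`sorry`); a separate light module (rather than an edition of the GLUE file) so that nothing above the GLUE rebuilds. (W-asm)
STEP 4′ «KEYED GLUE» of the T1-qs LAW 5 road of `Cruxes/H413/Lines/F0_T1InnerFormTraceIdentity.lean` (cell `pub/hodgecm-mathlib`,
crux H413), serving the (σ-i) central ∕ (σ-ii) singular FINSET CLOSERS of the three sockets of ★
`arthurTrace_eq_sum_orbital_add_sum_central_add_sum_singular_add_sum_hyperbolic_cm` (`UnitaryGroupArthurTraceThreeSockets`)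
and their `N = 2` siblings.

The sockets are filters `S.filter p` of the LAW-3 closer's finite index set whose predicate `p` says «the index is the refined
class of a rational representative of a given normal form» — a KEY `k` (a norm-one unit `z` for the central classes `(X − z)³`,
a pair `a ≠ b` of norm-one units for the singular classes `(X − a)²(X − b)`, a diagonal `d(a, b, (c a)⁻¹)` for the regular
hyperbolic ones) with `φ k = i`; the LAW-5 row closers are stated PER KEY: `J^T_{φ k}(f) = a_k·log T + b_k` for `T ≫ 0`
[Rogawski (6.1.3), (7.2.3), (7.3.2)]. The lemmas below turn such a keyed row closer into the FINSET statement the socket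
consumes — a (total) choice of keys `rep : ι → κ` on the filter, the class polynomials `P i = a·X + b` at `rep i`, and
`∑_{S.filter p} P_i(0) = ∑_{S.filter p} b (rep i)`:

* §1 (abstract, `J : ι → ℝ≥0 → ℂ`) **`exists_rep_sum_eval_zero_eq_of_forall_eval_log_eq`**; and for row closers whose
  constants are quantified AFTER the key (`∀ k, q k → ∃ e, r k e ∧ ∃ T₁, … a k e·log T + b k e` — the shape of ★
  `truncatedTraceClass_central_eq_linear_cm`, whose `C₀, C₁, C₂` sit behind the class data)
  **`exists_rep_const_sum_eval_zero_eq_of_forall_eval_log_eq`** (keys `rep` AND constants `cst` chosen on the filter);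
* §2 (the tree's letters, `J i T := truncatedTraceClass μ ν 𝓕 T cl i f`, generic `F, E, c, N, cl`)
  **`exists_rep_sum_classPolynomial_eval_zero_eq`**, **`exists_rep_const_sum_classPolynomial_eval_zero_eq`**.

## References

* J. Arthur, *The trace formula in invariant form*, Ann. of Math. 114 (1981), Prop. 2.3
  [Arthur1981TraceFormulaInvariantForm].
* J. D. Rogawski, *Automorphic Representations of Unitary Groups in Three Variables*, Ann. of Math. Stud. 123 (1990),
  §2.2–2.3 (pp. 13–14), §6.1 (6.1.3), §7.2 (7.2.3), §7.3 Prop. 7.3.2 [Rogawski1990].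
-/

set_option autoImplicit false

noncomputable section

open MeasureTheory Measure Set Polynomial
open scoped NNReal ENNReal

namespace Literature.NumberTheory.Automorphic

namespace UnitaryGroup

/-! ## §1 Abstract keyed glue -/

section Keyed

variable {ι κ : Type*} {J : ι → ℝ≥0 → ℂ}

/-- **KEYED ROW CLOSER ⇒ FINSET CLOSER** (abstract). Let `S` be a finite index set, `p` a filter predicate such that
every `i ∈ S` with `p i` has a key `k` with `q k` and `φ k = i`, and suppose the row closer holds per key:
`J (φ k) T = a k · log T + b k` for `T > T₁(k)`. If the socket polynomials satisfy `J i T = P_i(log T)` for `T > T₀(i)`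
(`i ∈ S`), then there is a (total) choice of keys `rep` with, on `S.filter p`: `q (rep i)`, `φ (rep i) = i`,
`P i = C (a (rep i)) * X + C (b (rep i))`, and `∑_{S.filter p} P_i(0) = ∑_{S.filter p} b (rep i)`.
[cite: Arthur1981TraceFormulaInvariantForm, Prop. 2.3] [cite: Rogawski1990, §2.2–2.3 (pp. 13–14)] -/
theorem exists_rep_sum_eval_zero_eq_of_forall_eval_log_eq [Nonempty κ] (S : Finset ι) (p : ι → Prop)
    [DecidablePred p] (φ : κ → ι) (q : κ → Prop) (hpq : ∀ i ∈ S, p i → ∃ k, q k ∧ φ k = i) {a b : κ → ℂ}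
    (hrow : ∀ k, q k → ∃ T₁ : ℝ≥0, ∀ T : ℝ≥0, T₁ < T → J (φ k) T = a k * ((Real.log (T : ℝ) : ℝ) : ℂ) + b k)
    (P : ι → ℂ[X])
    (hP : ∀ i ∈ S, ∃ T₀ : ℝ≥0, ∀ T : ℝ≥0, T₀ < T → J i T = (P i).eval ((Real.log (T : ℝ) : ℝ) : ℂ)) :
    ∃ rep : ι → κ, (∀ i ∈ S.filter p, q (rep i) ∧ φ (rep i) = i) ∧
      (∀ i ∈ S.filter p, P i = C (a (rep i)) * X + C (b (rep i))) ∧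
      ∑ i ∈ S.filter p, (P i).eval 0 = ∑ i ∈ S.filter p, b (rep i) := by
  have key : ∀ i, ∃ k : κ, i ∈ S.filter p → q k ∧ φ k = i := by
    intro i
    by_cases hi : i ∈ S.filter p
    · obtain ⟨k, hk, hki⟩ := hpq i (Finset.mem_filter.1 hi).1 (Finset.mem_filter.1 hi).2
      exact ⟨k, fun _ => ⟨hk, hki⟩⟩
    · exact ⟨Classical.arbitrary κ, fun h => (hi h).elim⟩
  choose rep hrep using key
  have hlin : ∀ i ∈ S.filter p, P i = C (a (rep i)) * X + C (b (rep i)) := by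
    intro i hi
    obtain ⟨hq, hφ⟩ := hrep i hi
    obtain ⟨T₀, hT₀⟩ := hP i (Finset.mem_filter.1 hi).1
    obtain ⟨T₁, hT₁⟩ := hrow (rep i) hq
    rw [hφ] at hT₁
    exact polynomial_eq_C_mul_X_add_C_of_forall_eval_log_eq (J := J i) hT₀ hT₁
  refine ⟨rep, hrep, hlin, Finset.sum_congr rfl fun i hi => ?_⟩
  rw [hlin i hi, eval_add, eval_mul, eval_C, eval_X, eval_C, mul_zero, zero_add]

/-- **KEYED ROW CLOSER WITH CONSTANTS BEHIND THE KEY ⇒ FINSET CLOSER** (abstract). Same as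
`exists_rep_sum_eval_zero_eq_of_forall_eval_log_eq` for a row closer of the shape
`∀ k, q k → ∃ e, r k e ∧ ∃ T₁, ∀ T > T₁, J (φ k) T = a k e · log T + b k e` (constants `e : ε` — e.g. the `(C₀, C₁, C₂)` of
★ `truncatedTraceClass_central_eq_linear_cm` — chosen per key): a choice of keys `rep` AND of constants `cst` on the filter
with `P i = C (a (rep i) (cst i)) * X + C (b (rep i) (cst i))` and `∑_{S.filter p} P_i(0) = ∑_{S.filter p} b (rep i) (cst i)`.
[cite: Arthur1981TraceFormulaInvariantForm, Prop. 2.3] [cite: Rogawski1990, §2.2–2.3 (pp. 13–14)] -/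
theorem exists_rep_const_sum_eval_zero_eq_of_forall_eval_log_eq {ε : Type*} [Nonempty κ] [Nonempty ε]
    (S : Finset ι) (p : ι → Prop) [DecidablePred p] (φ : κ → ι) (q : κ → Prop)
    (hpq : ∀ i ∈ S, p i → ∃ k, q k ∧ φ k = i) (r : κ → ε → Prop) {a b : κ → ε → ℂ}
    (hrow : ∀ k, q k → ∃ e, r k e ∧
      ∃ T₁ : ℝ≥0, ∀ T : ℝ≥0, T₁ < T → J (φ k) T = a k e * ((Real.log (T : ℝ) : ℝ) : ℂ) + b k e)
    (P : ι → ℂ[X])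
    (hP : ∀ i ∈ S, ∃ T₀ : ℝ≥0, ∀ T : ℝ≥0, T₀ < T → J i T = (P i).eval ((Real.log (T : ℝ) : ℝ) : ℂ)) :
    ∃ (rep : ι → κ) (cst : ι → ε), (∀ i ∈ S.filter p, q (rep i) ∧ φ (rep i) = i ∧ r (rep i) (cst i)) ∧
      (∀ i ∈ S.filter p, P i = C (a (rep i) (cst i)) * X + C (b (rep i) (cst i))) ∧
      ∑ i ∈ S.filter p, (P i).eval 0 = ∑ i ∈ S.filter p, b (rep i) (cst i) := by
  obtain ⟨rep', hrep', hlin', hsum'⟩ := exists_rep_sum_eval_zero_eq_of_forall_eval_log_eq (J := J) S p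
    (fun ke : κ × ε => φ ke.1)
    (fun ke : κ × ε => q ke.1 ∧ r ke.1 ke.2 ∧
      ∃ T₁ : ℝ≥0, ∀ T : ℝ≥0, T₁ < T → J (φ ke.1) T = a ke.1 ke.2 * ((Real.log (T : ℝ) : ℝ) : ℂ) + b ke.1 ke.2)
    (fun i hi hpi => by
      obtain ⟨k, hk, hki⟩ := hpq i hi hpi
      obtain ⟨e, he, hT⟩ := hrow k hk
      exact ⟨(k, e), ⟨hk, he, hT⟩, hki⟩)
    (a := fun ke : κ × ε => a ke.1 ke.2) (b := fun ke : κ × ε => b ke.1 ke.2) (fun ke hke => hke.2.2) P hP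
  exact ⟨fun i => (rep' i).1, fun i => (rep' i).2,
    fun i hi => ⟨(hrep' i hi).1.1, (hrep' i hi).2, (hrep' i hi).1.2.1⟩, hlin', hsum'⟩

end Keyed

/-! ## §2 The tree's letters: `J i T := truncatedTraceClass μ ν 𝓕 T cl i f` -/

section KeyedClass

variable {F E : Type} [Field F] [NumberField F] [Field E] [NumberField E] [Algebra F E]
  {c : E ≃ₐ[F] E} {N : ℕ} {ι κ : Type*} [NeZero N] [MeasurableSpace (adelicUnipotent F E c N)]
  {cl : (quasiSplit F E c N).arithmeticSubgroup → ι}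
  {μ : Measure (quasiSplit F E c N).automorphicQuotient}
  {ν : Measure (adelicUnipotent F E c N)} {𝓕 : Set (adelicUnipotent F E c N)}
  {f : (quasiSplit F E c N).Adelic → ℂ}

/-- **KEYED ROW CLOSER ⇒ FINSET CLOSER in the tree's letters** (`J i T := truncatedTraceClass μ ν 𝓕 T cl i f`, generic
`F, E, c, N, cl`): keys `rep` on the filter with `q (rep i)`, `φ (rep i) = i`, class polynomials `P i = a·X + b` at the
key, and `∑_{S.filter p} p_𝔬(0) = ∑_{S.filter p} b (rep i)` — the shape in which a socket of ★
`UnitaryGroupArthurTraceThreeSockets` is closed by a per-key LAW-5 row closer [Rogawski (6.1.3), (7.2.3), (7.3.2)].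
[cite: Arthur1981TraceFormulaInvariantForm, Prop. 2.3] [cite: Rogawski1990, §2.2–2.3 (pp. 13–14), §7.3 (7.3.2)] -/
theorem exists_rep_sum_classPolynomial_eval_zero_eq [Nonempty κ] (S : Finset ι) (p : ι → Prop) [DecidablePred p]
    (φ : κ → ι) (q : κ → Prop) (hpq : ∀ i ∈ S, p i → ∃ k, q k ∧ φ k = i) {a b : κ → ℂ}
    (hrow : ∀ k, q k → ∃ T₁ : ℝ≥0, ∀ T : ℝ≥0, T₁ < T →
      truncatedTraceClass μ ν 𝓕 T cl (φ k) f = a k * ((Real.log (T : ℝ) : ℝ) : ℂ) + b k)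
    (P : ι → ℂ[X]) (hP : ∀ i ∈ S, ∃ T₀ : ℝ≥0, ∀ T : ℝ≥0, T₀ < T →
      truncatedTraceClass μ ν 𝓕 T cl i f = (P i).eval ((Real.log (T : ℝ) : ℝ) : ℂ)) :
    ∃ rep : ι → κ, (∀ i ∈ S.filter p, q (rep i) ∧ φ (rep i) = i) ∧
      (∀ i ∈ S.filter p, P i = C (a (rep i)) * X + C (b (rep i))) ∧
      ∑ i ∈ S.filter p, (P i).eval 0 = ∑ i ∈ S.filter p, b (rep i) :=
  exists_rep_sum_eval_zero_eq_of_forall_eval_log_eq (J := fun i T => truncatedTraceClass μ ν 𝓕 T cl i f) S p φ q hpq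
    hrow P hP

/-- **KEYED ROW CLOSER WITH CONSTANTS BEHIND THE KEY ⇒ FINSET CLOSER in the tree's letters**: for a row closer
`∀ k, q k → ∃ e, r k e ∧ ∃ T₁, ∀ T > T₁, J^T_{φ k}(f) = a k e·log T + b k e` (★ `truncatedTraceClass_central_eq_linear_cm`'s
shape), keys `rep` and constants `cst` on the filter with `P i = a·X + b` there and
`∑_{S.filter p} p_𝔬(0) = ∑_{S.filter p} b (rep i) (cst i)`. [cite: Arthur1981TraceFormulaInvariantForm, Prop. 2.3]
[cite: Rogawski1990, §2.2–2.3 (pp. 13–14), §7.3 (7.3.2)] -/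
theorem exists_rep_const_sum_classPolynomial_eval_zero_eq {ε : Type*} [Nonempty κ] [Nonempty ε] (S : Finset ι)
    (p : ι → Prop) [DecidablePred p] (φ : κ → ι) (q : κ → Prop) (hpq : ∀ i ∈ S, p i → ∃ k, q k ∧ φ k = i)
    (r : κ → ε → Prop) {a b : κ → ε → ℂ}
    (hrow : ∀ k, q k → ∃ e, r k e ∧ ∃ T₁ : ℝ≥0, ∀ T : ℝ≥0, T₁ < T →
      truncatedTraceClass μ ν 𝓕 T cl (φ k) f = a k e * ((Real.log (T : ℝ) : ℝ) : ℂ) + b k e)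
    (P : ι → ℂ[X]) (hP : ∀ i ∈ S, ∃ T₀ : ℝ≥0, ∀ T : ℝ≥0, T₀ < T →
      truncatedTraceClass μ ν 𝓕 T cl i f = (P i).eval ((Real.log (T : ℝ) : ℝ) : ℂ)) :
    ∃ (rep : ι → κ) (cst : ι → ε), (∀ i ∈ S.filter p, q (rep i) ∧ φ (rep i) = i ∧ r (rep i) (cst i)) ∧
      (∀ i ∈ S.filter p, P i = C (a (rep i) (cst i)) * X + C (b (rep i) (cst i))) ∧
      ∑ i ∈ S.filter p, (P i).eval 0 = ∑ i ∈ S.filter p, b (rep i) (cst i) :=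
  exists_rep_const_sum_eval_zero_eq_of_forall_eval_log_eq (J := fun i T => truncatedTraceClass μ ν 𝓕 T cl i f) S p φ q
    hpq r hrow P hP

end KeyedClass

end UnitaryGroup

end Literature.NumberTheory.Automorphic
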